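import Mathlib
import Summits.AtomisticToContinuum.HydrodynamicLimit.Theorems.ImplosionDichotomyDenseExcursionSonicCavityDefs

/-!
# Pointwise differential inequalities of the acoustic standing-wave energies at the centre
# (crux `DenseExcursion`, line `sonic-cavity-renewal`, brick for `centreContent_of_tube`)

Helper file (`--supports stmt-AtomisticToContinuum-12586`, line lead a2, stub-worker W3 for `centreContent_of_tube`).

Pure real/complex arithmetic. In the travelling-wave pair `(v, z)` of the centre system (`…SonicCentreContentInnerSystem`:
`v′ = Θv + κz + E_v`, `z′ = Θz + κv + E_z`) the quadratic quantities `E = ‖v‖² + ‖z‖²` (total), `‖v − z‖²` (∝ the squared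
amplitude of the regular family `ŵ − 3ŝ`), `‖v + z‖²` (∝ that of `ŵ + 3ŝ`) and `N = ‖𝒰‖²/9 + ‖𝒮‖²` have the derivatives recorded in
`dE_alg`, `dEm_alg`, `dEp_alg`, `dN_alg`. Given the remainder bounds delivered by the point package (coefficient bounds of
`…SonicCentreContentInnerBounds`) this file turns them into LINEAR differential inequalities with explicit coefficients:
`inner_N_ineq` (registered helper; `N′ ≤ (11.22ρ + 21ρ²)N`), `inner_regionI_ineq` (deep region `ρ ≤ 1/‖Λ‖`, sizes controlled by
`N`), `inner_regionII_ineq` (`1/‖Λ‖ ≤ ρ ≤ ρ₀`, `|κ| ≥ 1`, sizes controlled by `E` alone). The two families decouple up to the single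
`O(ρ)` remainder `C ≈ −(2(2−r)/3)k` and `Re κ = Re Λ·k`; integrating (companion file) gives `‖v − z‖ ≈ ‖v + z‖` at `ρ₀ = 1/100`.

NOT here: the mode, the barriers, the limits.
-/

noncomputable section

namespace Summit.AtomisticToContinuum.HydrodynamicLimit.Theorems.SonicCavityRenewal

/-! ## Region II -/

/-- `Re(conj a · b) ≤ ‖a‖‖b‖`. [folklore] -/
theorem re_conj_mul_le (a b : ℂ) : (starRingEnd ℂ a * b).re ≤ ‖a‖ * ‖b‖ := by
  refine (Complex.re_le_norm _).trans ?_
  rw [norm_mul, Complex.norm_conj]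

/-- `|Re(conj a · b)| ≤ ‖a‖‖b‖`. [folklore] -/
theorem abs_re_conj_mul_le (a b : ℂ) : |(starRingEnd ℂ a * b).re| ≤ ‖a‖ * ‖b‖ := by
  have h := Complex.abs_re_le_norm (starRingEnd ℂ a * b)
  rwa [norm_mul, Complex.norm_conj] at h

/-- Weighted AM–GM with weights `7/5`, `5/7`. [folklore] -/
theorem two_mul_le_weighted (a b : ℝ) : 2 * a * b ≤ 7 / 5 * a ^ 2 + 5 / 7 * b ^ 2 := by
  nlinarith [mul_nonneg (by norm_num : (0:ℝ) ≤ 7 / 5) (sq_nonneg (a - 5 / 7 * b))]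


/-- Arithmetic core of the total-energy inequality on region II. [folklore] -/
theorem core_total (θ κr X R₁ R₂ nv nz nEv nEz m ρ : ℝ) (h1 : R₁ ≤ nv * nEv) (h2 : R₂ ≤ nz * nEz)
    (h7 : |κr * X| ≤ 432 / 100 * ρ * (nv * nz)) (h7' : κr * X ≤ |κr * X|)
    (h8ρ : 432 / 100 * ρ * (2 * (nv * nz)) ≤ 432 / 100 * ρ * (nv ^ 2 + nz ^ 2))
    (h9 : θ * (nv ^ 2 + nz ^ 2) ≤ 55 / 10 * ρ ^ 2 * (nv ^ 2 + nz ^ 2))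
    (hA : nv * nEv + nz * nEz ≤ (nv + nz) * (nEv + nEz)) (hB : (nv + nz) * (nEv + nEz) ≤ (nv + nz) * (m * (nv + nz)))
    (h11 : m * (nv + nz) ^ 2 ≤ m * (2 * (nv ^ 2 + nz ^ 2))) (hm : m = 516 / 100 * ρ + 185 / 10 * ρ ^ 2) :
    2 * θ * (nv ^ 2 + nz ^ 2) + 4 * κr * X + 2 * R₁ + 2 * R₂ ≤
      (864 / 100 * ρ + 11 * ρ ^ 2 + 4 * (516 / 100 * ρ + 185 / 10 * ρ ^ 2)) * (nv ^ 2 + nz ^ 2) := by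
  subst hm
  have h10 : (nv + nz) * ((516 / 100 * ρ + 185 / 10 * ρ ^ 2) * (nv + nz)) =
      (516 / 100 * ρ + 185 / 10 * ρ ^ 2) * (nv + nz) ^ 2 := by ring
  nlinarith [h1, h2, h7, h7', h8ρ, h9, hA, hB, h11, h10]

/-- Arithmetic core of the minus-family inequality on region II. [folklore] -/
theorem core_minus (θ a R ne m sv E ρ : ℝ) (h1 : R ≤ a * ne) (h4 : a * ne ≤ a * (m * sv))
    (h5 : m * (2 * a * sv) ≤ m * (7 / 5 * a ^ 2 + 5 / 7 * sv ^ 2))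
    (h7 : θ * a ^ 2 ≤ (36 / 100 * ρ + 55 / 10 * ρ ^ 2) * a ^ 2) (h8 : m * (5 / 7 * sv ^ 2) ≤ m * (5 / 7 * (2 * E)))
    (hm : m = 516 / 100 * ρ + 185 / 10 * ρ ^ 2) :
    2 * θ * a ^ 2 + 2 * R ≤ (72 / 100 * ρ + 11 * ρ ^ 2 + 7 / 5 * (516 / 100 * ρ + 185 / 10 * ρ ^ 2)) * a ^ 2 +
      10 / 7 * (516 / 100 * ρ + 185 / 10 * ρ ^ 2) * E := by
  subst hm
  nlinarith [h1, h4, h5, h7, h8]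

/-- Arithmetic core of the plus-family inequality on region II. [folklore] -/
theorem core_plus (θ a R ne m sv E ρ : ℝ) (h1 : |R| ≤ a * ne) (h1' : -|R| ≤ R) (h4 : a * ne ≤ a * (m * sv))
    (h5 : m * (2 * a * sv) ≤ m * (7 / 5 * a ^ 2 + 5 / 7 * sv ^ 2))
    (h7 : -(36 / 100 * ρ + 46 / 100 * ρ ^ 2) * a ^ 2 ≤ θ * a ^ 2) (h8 : m * (5 / 7 * sv ^ 2) ≤ m * (5 / 7 * (2 * E)))
    (hm : m = 516 / 100 * ρ + 185 / 10 * ρ ^ 2) :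
    -((72 / 100 * ρ + 92 / 100 * ρ ^ 2 + 7 / 5 * (516 / 100 * ρ + 185 / 10 * ρ ^ 2)) * a ^ 2) -
        10 / 7 * (516 / 100 * ρ + 185 / 10 * ρ ^ 2) * E ≤ 2 * θ * a ^ 2 + 2 * R := by
  subst hm
  nlinarith [h1, h1', h4, h5, h7, h8]

/-- **REGION II (`1/‖Λ‖ ≤ ρ ≤ 1/50`, `|κ| ≥ 1`) DIFFERENTIAL INEQUALITIES.** At a point where the travelling-wave pair
`(v, z)` of `…InnerSystem` has remainders bounded as delivered by the point package (`‖E_v‖ ≤ 11ρ²(‖v‖+‖𝒮‖) + …`,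
`‖E_z‖ ≤ 6.92ρ²‖z‖ + 0.86ρ|κ|‖𝒰‖`, `|Re Θ| ≤ 5.5ρ²`, `|Re κ| ≤ 4.32ρ`, `Re(Θ−κ) ≤ 0.36ρ + 5.5ρ²`, `Re(Θ+κ) ≥ −(0.36ρ + 0.46ρ²)`)
and `|κ| ≥ max(1, ρ‖Λ‖)`, `ρ‖Λ‖ ≥ 1`: with `m₂ = 5.16ρ + 18.5ρ²`, the right-hand sides of `dE_alg`, `dEm_alg`, `dEp_alg` satisfy
`(‖v‖²+‖z‖²)′ ≤ (8.64ρ + 11ρ² + 4m₂)(‖v‖²+‖z‖²)`, `(‖v−z‖²)′ ≤ (0.72ρ + 11ρ² + (7/5)m₂)‖v−z‖² + (10/7)m₂(‖v‖²+‖z‖²)`,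
`(‖v+z‖²)′ ≥ −(0.72ρ + 0.92ρ² + (7/5)m₂)‖v+z‖² − (10/7)m₂(‖v‖²+‖z‖²)` — the two acoustic families decouple up to `O(ρ)`. [folklore] -/
theorem inner_regionII_ineq (v z U S Θ κ Ev Ez : ℂ) (ρ L : ℝ) (hρ : 0 < ρ) (hρ₁ : ρ ≤ 1 / 50) (hL : 1000 ≤ L)
    (ht₁ : 1 ≤ ‖κ‖) (ht₂ : ρ * L ≤ ‖κ‖) (hρL : 1 ≤ ρ * L) (hU : κ / 3 * U = v - S) (hzS : z = κ * S)
    (hEv : ‖Ev‖ ≤ 11 * ρ ^ 2 * (‖v‖ + ‖S‖) + (42 / 100 * ρ ^ 2 + 74 / 100 * ‖κ‖ * ρ ^ 3) * ‖S‖ + 86 / 100 * ρ * ‖U‖)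
    (hEz : ‖Ez‖ ≤ 692 / 100 * ρ ^ 2 * ‖z‖ + 86 / 100 * ρ * ‖κ‖ * ‖U‖)
    (hΘ : |Θ.re| ≤ 55 / 10 * ρ ^ 2) (hκre : |κ.re| ≤ 432 / 100 * ρ)
    (hm : (Θ - κ).re ≤ 36 / 100 * ρ + 55 / 10 * ρ ^ 2) (hp : -(36 / 100 * ρ + 46 / 100 * ρ ^ 2) ≤ (Θ + κ).re) :
    (2 * Θ.re * (‖v‖ ^ 2 + ‖z‖ ^ 2) + 4 * κ.re * (starRingEnd ℂ v * z).re +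
        2 * (starRingEnd ℂ v * Ev).re + 2 * (starRingEnd ℂ z * Ez).re ≤
      (864 / 100 * ρ + 11 * ρ ^ 2 + 4 * (516 / 100 * ρ + 185 / 10 * ρ ^ 2)) * (‖v‖ ^ 2 + ‖z‖ ^ 2)) ∧
    (2 * (Θ - κ).re * ‖v - z‖ ^ 2 + 2 * (starRingEnd ℂ (v - z) * (Ev - Ez)).re ≤
      (72 / 100 * ρ + 11 * ρ ^ 2 + 7 / 5 * (516 / 100 * ρ + 185 / 10 * ρ ^ 2)) * ‖v - z‖ ^ 2 +
        10 / 7 * (516 / 100 * ρ + 185 / 10 * ρ ^ 2) * (‖v‖ ^ 2 + ‖z‖ ^ 2)) ∧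
    (-((72 / 100 * ρ + 92 / 100 * ρ ^ 2 + 7 / 5 * (516 / 100 * ρ + 185 / 10 * ρ ^ 2)) * ‖v + z‖ ^ 2) -
        10 / 7 * (516 / 100 * ρ + 185 / 10 * ρ ^ 2) * (‖v‖ ^ 2 + ‖z‖ ^ 2) ≤
      2 * (Θ + κ).re * ‖v + z‖ ^ 2 + 2 * (starRingEnd ℂ (v + z) * (Ev + Ez)).re) := by
  set m₂ := 516 / 100 * ρ + 185 / 10 * ρ ^ 2 with hm₂
  have hL0 : 0 < L := by linarith
  have ht0 : 0 < ‖κ‖ := by linarith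
  have hκ0 : κ ≠ 0 := fun h => by rw [h, norm_zero] at ht₁; linarith
  have hv0 := norm_nonneg v; have hz0 := norm_nonneg z; have hS0 := norm_nonneg S; have hU0 := norm_nonneg U
  -- ‖z‖ = ‖κ‖ ‖S‖ ≥ ‖S‖
  have hSz : ‖z‖ = ‖κ‖ * ‖S‖ := by rw [hzS, norm_mul]
  have hS1 : ‖S‖ ≤ ‖z‖ := by rw [hSz]; nlinarith
  -- ‖κ‖ ‖U‖ = 3‖v - S‖ ≤ 3(‖v‖ + ‖z‖)
  have hUeq : ‖κ‖ * ‖U‖ = 3 * ‖v - S‖ := by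
    have : U = 3 * (v - S) / κ := by rw [← hU]; field_simp
    rw [this, norm_div, norm_mul, Complex.norm_ofNat]
    field_simp
  have hU1 : ‖κ‖ * ‖U‖ ≤ 3 * (‖v‖ + ‖z‖) := by rw [hUeq]; linarith [norm_sub_le v S]
  have hU2 : ρ * ‖U‖ ≤ 3 / L * (‖v‖ + ‖z‖) := by
    have h1 : ρ * L * ‖U‖ ≤ ‖κ‖ * ‖U‖ := mul_le_mul_of_nonneg_right ht₂ hU0
    rw [div_mul_eq_mul_div, le_div_iff₀ hL0]
    nlinarith
  have hU3 : ρ * ‖U‖ ≤ 3 * ρ * (‖v‖ + ‖z‖) := by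
    refine hU2.trans ?_
    have h1 : 3 / L ≤ 3 * ρ := by
      rw [div_le_iff₀ hL0]
      have := mul_le_mul_of_nonneg_left hρL (by norm_num : (0:ℝ) ≤ 3)
      linarith only [this]
    exact mul_le_mul_of_nonneg_right h1 (by positivity)
  -- the combined remainder bound ‖Ev‖ + ‖Ez‖ ≤ m₂ (‖v‖ + ‖z‖)
  have hρ2 : ρ ^ 2 ≤ 1 / 2500 := by nlinarith
  have hρ3 : ρ ^ 3 ≤ 1 / 50 * ρ ^ 2 := by
    have := mul_le_mul_of_nonneg_right hρ₁ (sq_nonneg ρ)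
    calc ρ ^ 3 = ρ * ρ ^ 2 := by ring
      _ ≤ 1 / 50 * ρ ^ 2 := this
  have hsum : ‖Ev‖ + ‖Ez‖ ≤ m₂ * (‖v‖ + ‖z‖) := by
    have e1 : 74 / 100 * ‖κ‖ * ρ ^ 3 * ‖S‖ = 74 / 100 * ρ ^ 3 * ‖z‖ := by rw [hSz]; ring
    have s1 : 11 * ρ ^ 2 * (‖v‖ + ‖S‖) ≤ 11 * ρ ^ 2 * (‖v‖ + ‖z‖) :=
      mul_le_mul_of_nonneg_left (by linarith) (by positivity)
    have s2 : 42 / 100 * ρ ^ 2 * ‖S‖ ≤ 42 / 100 * ρ ^ 2 * ‖z‖ := mul_le_mul_of_nonneg_left hS1 (by positivity)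
    have s3 : 86 / 100 * ρ * ‖U‖ ≤ 86 / 100 * (3 * ρ * (‖v‖ + ‖z‖)) := by
      rw [mul_assoc]; exact mul_le_mul_of_nonneg_left hU3 (by norm_num)
    have s4 : 86 / 100 * ρ * ‖κ‖ * ‖U‖ ≤ 86 / 100 * ρ * (3 * (‖v‖ + ‖z‖)) := by
      rw [mul_assoc]; exact mul_le_mul_of_nonneg_left hU1 (by positivity)
    have s5 : 74 / 100 * ρ ^ 3 * ‖z‖ ≤ 74 / 100 * (1 / 50 * ρ ^ 2) * ‖z‖ :=
      mul_le_mul_of_nonneg_right (mul_le_mul_of_nonneg_left hρ3 (by norm_num)) hz0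
    have s6 : (692 / 100 + 42 / 100 + 74 / 100 * (1 / 50)) * ρ ^ 2 * ‖z‖ ≤ 185 / 10 * ρ ^ 2 * (‖v‖ + ‖z‖) := by
      have h1 : (692 / 100 + 42 / 100 + 74 / 100 * (1 / 50)) * ρ ^ 2 * ‖z‖ ≤ 185 / 10 * ρ ^ 2 * ‖z‖ :=
        mul_le_mul_of_nonneg_right (mul_le_mul_of_nonneg_right (by norm_num) (sq_nonneg ρ)) hz0
      have h2 : 185 / 10 * ρ ^ 2 * ‖z‖ ≤ 185 / 10 * ρ ^ 2 * (‖v‖ + ‖z‖) :=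
        mul_le_mul_of_nonneg_left (by linarith) (by positivity)
      linarith
    have e3 : 86 / 100 * (3 * ρ * (‖v‖ + ‖z‖)) = 258 / 100 * ρ * (‖v‖ + ‖z‖) := by ring
    have e4 : m₂ * (‖v‖ + ‖z‖) = 258 / 100 * ρ * (‖v‖ + ‖z‖) + 258 / 100 * ρ * (‖v‖ + ‖z‖) +
        185 / 10 * ρ ^ 2 * (‖v‖ + ‖z‖) := by rw [hm₂]; ring
    have hρ2z : 0 ≤ ρ ^ 2 * ‖v‖ := by positivity
    linarith
  have hm0 : 0 ≤ m₂ := by positivity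
  obtain ⟨hΘ₁, hΘ₂⟩ := abs_le.mp hΘ
  have h6 : (‖v‖ + ‖z‖) ^ 2 ≤ 2 * (‖v‖ ^ 2 + ‖z‖ ^ 2) := by
    have := two_mul_le_add_sq ‖v‖ ‖z‖
    nlinarith [this]
  refine ⟨?_, ?_, ?_⟩
  · -- total energy
    have h1 := re_conj_mul_le v Ev
    have h2 := re_conj_mul_le z Ez
    have h3 := abs_re_conj_mul_le v z
    have hA : ‖v‖ * ‖Ev‖ + ‖z‖ * ‖Ez‖ ≤ (‖v‖ + ‖z‖) * (‖Ev‖ + ‖Ez‖) := by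
      have e : (‖v‖ + ‖z‖) * (‖Ev‖ + ‖Ez‖) = ‖v‖ * ‖Ev‖ + ‖z‖ * ‖Ez‖ + (‖v‖ * ‖Ez‖ + ‖z‖ * ‖Ev‖) := by ring
      rw [e]
      exact le_add_of_nonneg_right (add_nonneg (mul_nonneg hv0 (norm_nonneg Ez)) (mul_nonneg hz0 (norm_nonneg Ev)))
    have hB : (‖v‖ + ‖z‖) * (‖Ev‖ + ‖Ez‖) ≤ (‖v‖ + ‖z‖) * (m₂ * (‖v‖ + ‖z‖)) :=
      mul_le_mul_of_nonneg_left hsum (by positivity)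
    have h7 : |κ.re * (starRingEnd ℂ v * z).re| ≤ 432 / 100 * ρ * (‖v‖ * ‖z‖) := by
      rw [abs_mul]; exact mul_le_mul hκre h3 (abs_nonneg _) (by positivity)
    have h7' := le_abs_self (κ.re * (starRingEnd ℂ v * z).re)
    have h8 : 2 * (‖v‖ * ‖z‖) ≤ ‖v‖ ^ 2 + ‖z‖ ^ 2 := by have := two_mul_le_add_sq ‖v‖ ‖z‖; linarith
    have h8ρ : 432 / 100 * ρ * (2 * (‖v‖ * ‖z‖)) ≤ 432 / 100 * ρ * (‖v‖ ^ 2 + ‖z‖ ^ 2) :=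
      mul_le_mul_of_nonneg_left h8 (by positivity)
    have h9 : Θ.re * (‖v‖ ^ 2 + ‖z‖ ^ 2) ≤ 55 / 10 * ρ ^ 2 * (‖v‖ ^ 2 + ‖z‖ ^ 2) :=
      mul_le_mul_of_nonneg_right hΘ₂ (by positivity)
    have h11 : m₂ * (‖v‖ + ‖z‖) ^ 2 ≤ m₂ * (2 * (‖v‖ ^ 2 + ‖z‖ ^ 2)) := mul_le_mul_of_nonneg_left h6 hm0
    exact core_total _ _ _ _ _ _ _ _ _ _ _ h1 h2 h7 h7' h8ρ h9 hA hB h11 hm₂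
  · -- minus family
    have h1 := re_conj_mul_le (v - z) (Ev - Ez)
    have h2 : ‖Ev - Ez‖ ≤ m₂ * (‖v‖ + ‖z‖) := (norm_sub_le _ _).trans hsum
    have ha0 := norm_nonneg (v - z)
    have h3 := two_mul_le_weighted ‖v - z‖ (‖v‖ + ‖z‖)
    have h4 : ‖v - z‖ * ‖Ev - Ez‖ ≤ ‖v - z‖ * (m₂ * (‖v‖ + ‖z‖)) := mul_le_mul_of_nonneg_left h2 ha0
    have h5 : m₂ * (2 * ‖v - z‖ * (‖v‖ + ‖z‖)) ≤ m₂ * (7 / 5 * ‖v - z‖ ^ 2 + 5 / 7 * (‖v‖ + ‖z‖) ^ 2) :=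
      mul_le_mul_of_nonneg_left h3 hm0
    have h7 : (Θ - κ).re * ‖v - z‖ ^ 2 ≤ (36 / 100 * ρ + 55 / 10 * ρ ^ 2) * ‖v - z‖ ^ 2 :=
      mul_le_mul_of_nonneg_right hm (by positivity)
    have h8 : m₂ * (5 / 7 * (‖v‖ + ‖z‖) ^ 2) ≤ m₂ * (5 / 7 * (2 * (‖v‖ ^ 2 + ‖z‖ ^ 2))) :=
      mul_le_mul_of_nonneg_left (mul_le_mul_of_nonneg_left h6 (by norm_num)) hm0
    exact core_minus _ _ _ _ _ _ _ _ h1 h4 h5 h7 h8 hm₂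
  · -- plus family
    have h1 := abs_re_conj_mul_le (v + z) (Ev + Ez)
    have h1' := neg_abs_le (starRingEnd ℂ (v + z) * (Ev + Ez)).re
    have h2 : ‖Ev + Ez‖ ≤ m₂ * (‖v‖ + ‖z‖) := (norm_add_le _ _).trans hsum
    have ha0 := norm_nonneg (v + z)
    have h3 := two_mul_le_weighted ‖v + z‖ (‖v‖ + ‖z‖)
    have h4 : ‖v + z‖ * ‖Ev + Ez‖ ≤ ‖v + z‖ * (m₂ * (‖v‖ + ‖z‖)) := mul_le_mul_of_nonneg_left h2 ha0
    have h5 : m₂ * (2 * ‖v + z‖ * (‖v‖ + ‖z‖)) ≤ m₂ * (7 / 5 * ‖v + z‖ ^ 2 + 5 / 7 * (‖v‖ + ‖z‖) ^ 2) :=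
      mul_le_mul_of_nonneg_left h3 hm0
    have h7 : -(36 / 100 * ρ + 46 / 100 * ρ ^ 2) * ‖v + z‖ ^ 2 ≤ (Θ + κ).re * ‖v + z‖ ^ 2 :=
      mul_le_mul_of_nonneg_right hp (by positivity)
    have h8 : m₂ * (5 / 7 * (‖v‖ + ‖z‖) ^ 2) ≤ m₂ * (5 / 7 * (2 * (‖v‖ ^ 2 + ‖z‖ ^ 2))) :=
      mul_le_mul_of_nonneg_left (mul_le_mul_of_nonneg_left h6 (by norm_num)) hm0
    exact core_plus _ _ _ _ _ _ _ _ h1 h1' h4 h5 h7 h8 hm₂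

/-! ## The a priori quantity `N` and region I -/

/-- Arithmetic core of the a priori inequality for `N = ‖𝒰‖²/9 + ‖𝒮‖²`. [folklore] -/
theorem coreN (θ κr A B C D nU nS X ρ : ℝ) (hX : |X| ≤ nU * nS)
    (hA : |A| ≤ 9 / 2 * ρ ^ 2) (hB : |B| ≤ 11 / 5 * ρ ^ 3) (hC : |C| ≤ 43 / 50 * ρ) (hD : |D| ≤ 21 / 50 * ρ ^ 2)
    (hθ : |θ| ≤ 55 / 10 * ρ ^ 2) (hκ : |κr| ≤ 432 / 100 * ρ) (hρ : 0 < ρ) (hρ₁ : ρ ≤ 1 / 50) :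
    2 * θ * (nU ^ 2 / 9 + nS ^ 2) - 4 / 9 * nU ^ 2 + 2 * A / 9 * nU ^ 2 + 2 * D * nS ^ 2 +
        (4 / 3 * κr + 2 * B / 9 + 2 * C) * X ≤ (1122 / 100 * ρ + 21 * ρ ^ 2) * (nU ^ 2 / 9 + nS ^ 2) := by
  obtain ⟨hA₁, hA₂⟩ := abs_le.mp hA
  obtain ⟨hD₁, hD₂⟩ := abs_le.mp hD
  obtain ⟨hθ₁, hθ₂⟩ := abs_le.mp hθ
  have hN0 : 0 ≤ nU ^ 2 / 9 + nS ^ 2 := by positivity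
  have hco : |4 / 3 * κr + 2 * B / 9 + 2 * C| ≤ 4 / 3 * (432 / 100 * ρ) + 2 / 9 * (11 / 5 * ρ ^ 3) + 2 * (43 / 50 * ρ) := by
    refine (abs_add_le _ _).trans (add_le_add ((abs_add_le _ _).trans (add_le_add ?_ ?_)) ?_)
    · rw [abs_mul, abs_of_pos (by norm_num : (0:ℝ) < 4/3)]; exact mul_le_mul_of_nonneg_left hκ (by norm_num)
    · rw [abs_div, abs_mul, abs_of_pos (by norm_num : (0:ℝ) < 2), abs_of_pos (by norm_num : (0:ℝ) < 9)]
      linarith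
    · rw [abs_mul, abs_of_pos (by norm_num : (0:ℝ) < 2)]; exact mul_le_mul_of_nonneg_left hC (by norm_num)
  have hcross : |(4 / 3 * κr + 2 * B / 9 + 2 * C) * X| ≤
      (4 / 3 * (432 / 100 * ρ) + 2 / 9 * (11 / 5 * ρ ^ 3) + 2 * (43 / 50 * ρ)) * (nU * nS) := by
    rw [abs_mul]
    exact mul_le_mul hco hX (abs_nonneg _) (by positivity)
  have hc' := le_abs_self ((4 / 3 * κr + 2 * B / 9 + 2 * C) * X)
  have hUS : nU * nS ≤ 3 / 2 * (nU ^ 2 / 9 + nS ^ 2) := by nlinarith [sq_nonneg (nU / 3 - nS)]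
  have hρ3 : ρ ^ 3 ≤ 1 / 50 * ρ ^ 2 := by
    have := mul_le_mul_of_nonneg_right hρ₁ (sq_nonneg ρ)
    calc ρ ^ 3 = ρ * ρ ^ 2 := by ring
      _ ≤ 1 / 50 * ρ ^ 2 := this
  have h1 : θ * (nU ^ 2 / 9 + nS ^ 2) ≤ 55 / 10 * ρ ^ 2 * (nU ^ 2 / 9 + nS ^ 2) := mul_le_mul_of_nonneg_right hθ₂ hN0
  have h2 : A * nU ^ 2 ≤ 9 / 2 * ρ ^ 2 * nU ^ 2 := mul_le_mul_of_nonneg_right hA₂ (sq_nonneg _)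
  have h3 : D * nS ^ 2 ≤ 21 / 50 * ρ ^ 2 * nS ^ 2 := mul_le_mul_of_nonneg_right hD₂ (sq_nonneg _)
  have h4 : (4 / 3 * (432 / 100 * ρ) + 2 / 9 * (11 / 5 * ρ ^ 3) + 2 * (43 / 50 * ρ)) * (nU * nS) ≤
      (4 / 3 * (432 / 100 * ρ) + 2 / 9 * (11 / 5 * ρ ^ 3) + 2 * (43 / 50 * ρ)) * (3 / 2 * (nU ^ 2 / 9 + nS ^ 2)) :=
    mul_le_mul_of_nonneg_left hUS (by positivity)
  have h5 : ρ ^ 3 * (nU ^ 2 / 9 + nS ^ 2) ≤ 1 / 50 * ρ ^ 2 * (nU ^ 2 / 9 + nS ^ 2) :=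
    mul_le_mul_of_nonneg_right hρ3 hN0
  have h6 : 0 ≤ ρ ^ 2 * (nU ^ 2 / 9) := by positivity
  have h7 : 0 ≤ nU ^ 2 := sq_nonneg _
  have h8 : 0 ≤ ρ ^ 2 * nS ^ 2 := by positivity
  have e1 : (4 / 3 * (432 / 100 * ρ) + 2 / 9 * (11 / 5 * ρ ^ 3) + 2 * (43 / 50 * ρ)) * (3 / 2 * (nU ^ 2 / 9 + nS ^ 2)) =
      1122 / 100 * ρ * (nU ^ 2 / 9 + nS ^ 2) + 11 / 15 * (ρ ^ 3 * (nU ^ 2 / 9 + nS ^ 2)) := by ring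
  linarith [h1, h2, h3, h4, hcross, hc', h5, h6, h7, h8, e1]

/-- Arithmetic core of the total-energy inequality on region I. [folklore] -/
theorem coreI_total (θ κr X R₁ R₂ nv nz nS nU nEv nEz Nb ρ : ℝ) (hv : 0 ≤ nv) (hz : 0 ≤ nz) (hρ : 0 < ρ)
    (h1 : R₁ ≤ nv * nEv) (h2 : R₂ ≤ nz * nEz) (hX : |X| ≤ nv * nz) (hθ : θ ≤ 55 / 10 * ρ ^ 2)
    (hκ : |κr| ≤ 432 / 100 * ρ) (hUN : nU ^ 2 ≤ 9 * Nb) (hSN : nS ^ 2 ≤ Nb)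
    (hEv : nEv ≤ 11 * ρ ^ 2 * nv + 115 / 10 * ρ ^ 2 * nS + 86 / 100 * ρ * nU)
    (hEz : nEz ≤ 692 / 100 * ρ ^ 2 * nz + 124 / 100 * ρ * nU) :
    2 * θ * (nv ^ 2 + nz ^ 2) + 4 * κr * X + 2 * R₁ + 2 * R₂ ≤
      (1236 / 100 * ρ + 445 / 10 * ρ ^ 2) * (nv ^ 2 + nz ^ 2) + (63 / 10 * ρ + 115 / 10 * ρ ^ 2) * Nb := by
  obtain ⟨hκ₁, hκ₂⟩ := abs_le.mp hκ
  obtain ⟨hX₁, hX₂⟩ := abs_le.mp hX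
  have a1 : nv * nEv ≤ nv * (11 * ρ ^ 2 * nv + 115 / 10 * ρ ^ 2 * nS + 86 / 100 * ρ * nU) :=
    mul_le_mul_of_nonneg_left hEv hv
  have a2 : nz * nEz ≤ nz * (692 / 100 * ρ ^ 2 * nz + 124 / 100 * ρ * nU) := mul_le_mul_of_nonneg_left hEz hz
  have b1 : 2 * (nv * nS) ≤ nv ^ 2 + nS ^ 2 := two_mul_le_add_sq nv nS |>.trans_eq' (by ring)
  have b2 : 2 * (nv * nU) ≤ 3 * nv ^ 2 + nU ^ 2 / 3 := by nlinarith [sq_nonneg (nv - nU / 3)]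
  have b3 : 2 * (nz * nU) ≤ 3 * nz ^ 2 + nU ^ 2 / 3 := by nlinarith [sq_nonneg (nz - nU / 3)]
  have b4 : 2 * (nv * nz) ≤ nv ^ 2 + nz ^ 2 := two_mul_le_add_sq nv nz |>.trans_eq' (by ring)
  have c1 : κr * X ≤ 432 / 100 * ρ * (nv * nz) := by
    rcases le_or_gt 0 X with h | h <;> nlinarith
  have hρ2 : 0 ≤ ρ ^ 2 := sq_nonneg ρ
  nlinarith [mul_le_mul_of_nonneg_left b1 (by positivity : (0:ℝ) ≤ 115 / 10 * ρ ^ 2),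
    mul_le_mul_of_nonneg_left b2 (by positivity : (0:ℝ) ≤ 86 / 100 * ρ),
    mul_le_mul_of_nonneg_left b3 (by positivity : (0:ℝ) ≤ 124 / 100 * ρ),
    mul_le_mul_of_nonneg_left b4 (by positivity : (0:ℝ) ≤ 432 / 100 * ρ),
    mul_le_mul_of_nonneg_left hUN hρ.le, mul_le_mul_of_nonneg_left hSN hρ2,
    mul_le_mul_of_nonneg_left hUN hρ2, mul_nonneg hρ2 (sq_nonneg nv), mul_nonneg hρ2 (sq_nonneg nz)]

/-- Arithmetic core of the minus-family inequality on region I. [folklore] -/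
theorem coreI_minus (θ a R nE nv nz nS nU E Nb ρ : ℝ) (ha : 0 ≤ a) (hρ : 0 < ρ) (h1 : R ≤ a * nE) (hθ : θ ≤ 36 / 100 * ρ + 55 / 10 * ρ ^ 2)
    (hUN : nU ^ 2 ≤ 9 * Nb) (hSN : nS ^ 2 ≤ Nb) (hE : (nv + nz) ^ 2 ≤ 2 * E)
    (hsum : nE ≤ 11 * ρ ^ 2 * (nv + nz) + 115 / 10 * ρ ^ 2 * nS + 21 / 10 * ρ * nU) :
    2 * θ * a ^ 2 + 2 * R ≤ (702 / 100 * ρ + 335 / 10 * ρ ^ 2) * a ^ 2 +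
      (22 * ρ ^ 2 * E + (63 / 10 * ρ + 115 / 10 * ρ ^ 2) * Nb) := by
  have a1 : a * nE ≤ a * (11 * ρ ^ 2 * (nv + nz) + 115 / 10 * ρ ^ 2 * nS + 21 / 10 * ρ * nU) :=
    mul_le_mul_of_nonneg_left hsum ha
  have b1 : 2 * (a * (nv + nz)) ≤ a ^ 2 + (nv + nz) ^ 2 := two_mul_le_add_sq a (nv + nz) |>.trans_eq' (by ring)
  have b2 : 2 * (a * nS) ≤ a ^ 2 + nS ^ 2 := two_mul_le_add_sq a nS |>.trans_eq' (by ring)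
  have b3 : 2 * (a * nU) ≤ 3 * a ^ 2 + nU ^ 2 / 3 := by nlinarith [sq_nonneg (a - nU / 3)]
  have hρ2 : 0 ≤ ρ ^ 2 := sq_nonneg ρ
  nlinarith [mul_le_mul_of_nonneg_left b1 (by positivity : (0:ℝ) ≤ 11 * ρ ^ 2),
    mul_le_mul_of_nonneg_left b2 (by positivity : (0:ℝ) ≤ 115 / 10 * ρ ^ 2),
    mul_le_mul_of_nonneg_left b3 (by positivity : (0:ℝ) ≤ 21 / 10 * ρ),
    mul_le_mul_of_nonneg_left hUN hρ.le, mul_le_mul_of_nonneg_left hSN hρ2,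
    mul_le_mul_of_nonneg_left hE hρ2, mul_nonneg hρ2 (sq_nonneg a), mul_nonneg hρ.le (sq_nonneg a)]

/-- Arithmetic core of the plus-family inequality on region I. [folklore] -/
theorem coreI_plus (θ a R nE nv nz nS nU E Nb ρ : ℝ) (ha : 0 ≤ a) (hρ : 0 < ρ) (h1 : |R| ≤ a * nE) (hθ : -(36 / 100 * ρ + 46 / 100 * ρ ^ 2) ≤ θ)
    (hUN : nU ^ 2 ≤ 9 * Nb) (hSN : nS ^ 2 ≤ Nb) (hE : (nv + nz) ^ 2 ≤ 2 * E)
    (hsum : nE ≤ 11 * ρ ^ 2 * (nv + nz) + 115 / 10 * ρ ^ 2 * nS + 21 / 10 * ρ * nU) :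
    -((702 / 100 * ρ + 2342 / 100 * ρ ^ 2) * a ^ 2) - (22 * ρ ^ 2 * E + (63 / 10 * ρ + 115 / 10 * ρ ^ 2) * Nb) ≤
      2 * θ * a ^ 2 + 2 * R := by
  have hR := neg_abs_le R
  have a1 : a * nE ≤ a * (11 * ρ ^ 2 * (nv + nz) + 115 / 10 * ρ ^ 2 * nS + 21 / 10 * ρ * nU) :=
    mul_le_mul_of_nonneg_left hsum ha
  have b1 : 2 * (a * (nv + nz)) ≤ a ^ 2 + (nv + nz) ^ 2 := two_mul_le_add_sq a (nv + nz) |>.trans_eq' (by ring)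
  have b2 : 2 * (a * nS) ≤ a ^ 2 + nS ^ 2 := two_mul_le_add_sq a nS |>.trans_eq' (by ring)
  have b3 : 2 * (a * nU) ≤ 3 * a ^ 2 + nU ^ 2 / 3 := by nlinarith [sq_nonneg (a - nU / 3)]
  have hρ2 : 0 ≤ ρ ^ 2 := sq_nonneg ρ
  nlinarith [mul_le_mul_of_nonneg_left b1 (by positivity : (0:ℝ) ≤ 11 * ρ ^ 2),
    mul_le_mul_of_nonneg_left b2 (by positivity : (0:ℝ) ≤ 115 / 10 * ρ ^ 2),
    mul_le_mul_of_nonneg_left b3 (by positivity : (0:ℝ) ≤ 21 / 10 * ρ),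
    mul_le_mul_of_nonneg_left hUN hρ.le, mul_le_mul_of_nonneg_left hSN hρ2,
    mul_le_mul_of_nonneg_left hE hρ2, mul_nonneg hρ2 (sq_nonneg a), mul_nonneg hρ.le (sq_nonneg a)]

/-- **Registered helper `inner_N_ineq`: THE A PRIORI INEQUALITY FOR `N = ‖𝒰‖²/9 + ‖𝒮‖²`** (any `ρ ≤ 1/50`): with the
coefficient bounds of `…InnerBounds`, the right-hand side of `dN_alg` is `≤ (11.22ρ + 21ρ²)N` — the `κ`-coupling of the centre
system is antisymmetric in these weights up to `Re κ = O(ρ)`, and `−(4/9)‖𝒰‖² ≤ 0`. [folklore] -/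
theorem inner_N_ineq : ∀ (U S Θ κ : ℂ) (A B C D ρ : ℝ), 0 < ρ → ρ ≤ 1 / 50 → |A| ≤ 9 / 2 * ρ ^ 2 → |B| ≤ 11 / 5 * ρ ^ 3 → |C| ≤ 43 / 50 * ρ → |D| ≤ 21 / 50 * ρ ^ 2 → |Θ.re| ≤ 55 / 10 * ρ ^ 2 → |κ.re| ≤ 432 / 100 * ρ → 2 * Θ.re * (‖U‖ ^ 2 / 9 + ‖S‖ ^ 2) - 4 / 9 * ‖U‖ ^ 2 + 2 * A / 9 * ‖U‖ ^ 2 + 2 * D * ‖S‖ ^ 2 + (4 / 3 * κ.re + 2 * B / 9 + 2 * C) * (starRingEnd ℂ U * S).re ≤ (1122 / 100 * ρ + 21 * ρ ^ 2) * (‖U‖ ^ 2 / 9 + ‖S‖ ^ 2) :=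
  fun U S _ _ _ _ _ _ _ hρ hρ₁ hA hB hC hD hΘ hκ => coreN _ _ _ _ _ _ _ _ _ _ (abs_re_conj_mul_le U S) hA hB hC hD hΘ hκ hρ hρ₁

/-- **REGION I (`ρ ≤ 1/‖Λ‖ ≤ 1/1000`, `|κ| ≤ 1.44`) DIFFERENTIAL INEQUALITIES**, with the centre sizes controlled by an a
priori bound `‖𝒰‖² ≤ 9N̄`, `‖𝒮‖² ≤ N̄`: `(‖v‖²+‖z‖²)′ ≤ (12.36ρ + 44.5ρ²)(‖v‖²+‖z‖²) + (6.3ρ + 11.5ρ²)N̄`,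
`(‖v−z‖²)′ ≤ (7.02ρ + 33.5ρ²)‖v−z‖² + 22ρ²(‖v‖²+‖z‖²) + (6.3ρ + 11.5ρ²)N̄`,
`(‖v+z‖²)′ ≥ −(7.02ρ + 23.42ρ²)‖v+z‖² − 22ρ²(‖v‖²+‖z‖²) − (6.3ρ + 11.5ρ²)N̄`. [folklore] -/
theorem inner_regionI_ineq (v z U S Θ κ Ev Ez : ℂ) (ρ Nb : ℝ) (hρ : 0 < ρ) (hρ₁ : ρ ≤ 1 / 1000)
    (ht : ‖κ‖ ≤ 144 / 100) (hUN : ‖U‖ ^ 2 ≤ 9 * Nb) (hSN : ‖S‖ ^ 2 ≤ Nb)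
    (hEv : ‖Ev‖ ≤ 11 * ρ ^ 2 * (‖v‖ + ‖S‖) + (42 / 100 * ρ ^ 2 + 74 / 100 * ‖κ‖ * ρ ^ 3) * ‖S‖ + 86 / 100 * ρ * ‖U‖)
    (hEz : ‖Ez‖ ≤ 692 / 100 * ρ ^ 2 * ‖z‖ + 86 / 100 * ρ * ‖κ‖ * ‖U‖)
    (hΘ : |Θ.re| ≤ 55 / 10 * ρ ^ 2) (hκre : |κ.re| ≤ 432 / 100 * ρ)
    (hm : (Θ - κ).re ≤ 36 / 100 * ρ + 55 / 10 * ρ ^ 2) (hp : -(36 / 100 * ρ + 46 / 100 * ρ ^ 2) ≤ (Θ + κ).re) :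
    (2 * Θ.re * (‖v‖ ^ 2 + ‖z‖ ^ 2) + 4 * κ.re * (starRingEnd ℂ v * z).re +
        2 * (starRingEnd ℂ v * Ev).re + 2 * (starRingEnd ℂ z * Ez).re ≤
      (1236 / 100 * ρ + 445 / 10 * ρ ^ 2) * (‖v‖ ^ 2 + ‖z‖ ^ 2) + (63 / 10 * ρ + 115 / 10 * ρ ^ 2) * Nb) ∧
    (2 * (Θ - κ).re * ‖v - z‖ ^ 2 + 2 * (starRingEnd ℂ (v - z) * (Ev - Ez)).re ≤
      (702 / 100 * ρ + 335 / 10 * ρ ^ 2) * ‖v - z‖ ^ 2 +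
        (22 * ρ ^ 2 * (‖v‖ ^ 2 + ‖z‖ ^ 2) + (63 / 10 * ρ + 115 / 10 * ρ ^ 2) * Nb)) ∧
    (-((702 / 100 * ρ + 2342 / 100 * ρ ^ 2) * ‖v + z‖ ^ 2) -
        (22 * ρ ^ 2 * (‖v‖ ^ 2 + ‖z‖ ^ 2) + (63 / 10 * ρ + 115 / 10 * ρ ^ 2) * Nb) ≤
      2 * (Θ + κ).re * ‖v + z‖ ^ 2 + 2 * (starRingEnd ℂ (v + z) * (Ev + Ez)).re) := by
  have hv0 := norm_nonneg v; have hz0 := norm_nonneg z; have hS0 := norm_nonneg S; have hU0 := norm_nonneg U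
  have hκ0 := norm_nonneg κ
  obtain ⟨hΘ₁, hΘ₂⟩ := abs_le.mp hΘ
  -- simplified remainder bounds on region I
  have hρ2 : ρ ^ 2 ≤ 1 / 1000000 := by nlinarith
  have hEv' : ‖Ev‖ ≤ 11 * ρ ^ 2 * ‖v‖ + 115 / 10 * ρ ^ 2 * ‖S‖ + 86 / 100 * ρ * ‖U‖ := by
    have h1 : 74 / 100 * ‖κ‖ * ρ ^ 3 * ‖S‖ ≤ 74 / 100 * (144 / 100) * (1 / 1000 * ρ ^ 2) * ‖S‖ := by
      have hρ3 : ρ ^ 3 ≤ 1 / 1000 * ρ ^ 2 := by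
        have := mul_le_mul_of_nonneg_right hρ₁ (sq_nonneg ρ)
        calc ρ ^ 3 = ρ * ρ ^ 2 := by ring
          _ ≤ 1 / 1000 * ρ ^ 2 := this
      have := mul_le_mul ht hρ3 (by positivity) (by norm_num)
      nlinarith
    nlinarith [mul_nonneg (sq_nonneg ρ) hS0]
  have hEz' : ‖Ez‖ ≤ 692 / 100 * ρ ^ 2 * ‖z‖ + 124 / 100 * ρ * ‖U‖ := by
    have h1 : 86 / 100 * ρ * ‖κ‖ * ‖U‖ ≤ 86 / 100 * ρ * (144 / 100) * ‖U‖ := by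
      have := mul_le_mul_of_nonneg_left ht (by positivity : (0:ℝ) ≤ 86 / 100 * ρ)
      exact mul_le_mul_of_nonneg_right (by linarith) hU0
    nlinarith [mul_nonneg hρ.le hU0]
  have hsum : ‖Ev‖ + ‖Ez‖ ≤ 11 * ρ ^ 2 * (‖v‖ + ‖z‖) + 115 / 10 * ρ ^ 2 * ‖S‖ + 21 / 10 * ρ * ‖U‖ := by
    nlinarith [mul_nonneg (sq_nonneg ρ) hz0]
  have hE : (‖v‖ + ‖z‖) ^ 2 ≤ 2 * (‖v‖ ^ 2 + ‖z‖ ^ 2) := by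
    have := two_mul_le_add_sq ‖v‖ ‖z‖
    nlinarith [this]
  refine ⟨?_, ?_, ?_⟩
  · exact coreI_total _ _ _ _ _ _ _ _ _ _ _ _ _ hv0 hz0 hρ (re_conj_mul_le v Ev) (re_conj_mul_le z Ez)
      (abs_re_conj_mul_le v z) hΘ₂ hκre hUN hSN hEv' hEz'
  · have h1 := re_conj_mul_le (v - z) (Ev - Ez)
    have h2 : ‖Ev - Ez‖ ≤ 11 * ρ ^ 2 * (‖v‖ + ‖z‖) + 115 / 10 * ρ ^ 2 * ‖S‖ + 21 / 10 * ρ * ‖U‖ :=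
      (norm_sub_le _ _).trans hsum
    exact coreI_minus _ _ _ _ _ _ _ _ _ _ _ (norm_nonneg _) hρ h1 hm hUN hSN hE h2
  · have h1 := abs_re_conj_mul_le (v + z) (Ev + Ez)
    have h2 : ‖Ev + Ez‖ ≤ 11 * ρ ^ 2 * (‖v‖ + ‖z‖) + 115 / 10 * ρ ^ 2 * ‖S‖ + 21 / 10 * ρ * ‖U‖ :=
      (norm_add_le _ _).trans hsum
    exact coreI_plus _ _ _ _ _ _ _ _ _ _ _ (norm_nonneg _) hρ h1 hp hUN hSN hE h2

end Summit.AtomisticToContinuum.HydrodynamicLimit.Theorems.SonicCavityRenewal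

end
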